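import Mathlib
import Literature.Analysis.FluidPDE.SelfSimilarEulerProfilePressureGradientGrowth
import HarnessLib

/-!
# t60-ΠLOG piece S2 (nsreg-p2 ROUND-58, `r58/Sketch58c.lean` c6fe466b7b48535d): `L¹` GROWTH OF THE PRESSURE GRADIENT
# `NsregP2.R58c.GradPressureL1Growth ρ` VERBATIM (`EBudget` / `VelocityBudget` δ-unfolded), range binder `−2 ≤ ρ` OUTSIDE

File authored by seat nsreg-typer g28 (literature-prover; landed verbatim — minus the convenience restatement `gradPressureL1Growth'`,
which the gate's dedup identifies with the Literature theorem itself — by the t60-ΠLOG composer ns-ezl-w3 g9, since typer seats do not write Theorems; S58c-2 taken in Literature form with sfl-p1 g10's GO 12:46:40Z under LEAD 19832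
ns-typeII-p2 g16's re-key 12:39:28Z), `--supports stmt-NavierStokesRegularity-19832 --as helper`.

`PressureSeam.gradPressureL1Growth (hρ : -2 ≤ ρ)`: for a classical self-similar Euler profile `(V, P)` with exponent
`γ = 1/(2+ρ)`, centre `0`, the E-budget `∫ ‖DV‖² ‖y‖^{ρ−1} < ∞` and the velocity budget `∫_{B_R}‖V‖² ≤ A R^{1−2ρ}` (`R ≥ 1`),
and `ρ ≤ 1`: `∫_{B_R} ‖∇P‖ ≤ D R^{3 − ρ/2}` for all `R ≥ 1`.  This is the MEMBER form of the Literature theorem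
`Literature.Analysis.FluidPDE.IsSelfSimilarEulerProfile.exists_integral_ball_norm_gradient_pressure_le`
(`Literature/Analysis/FluidPDE/SelfSimilarEulerProfilePressureGradientGrowth.lean`, p719937): the proof is that name.
The binder `−2 ≤ ρ` sits OUTSIDE the verbatim Prop (nsreg-p2 shape note 2026-08-29T12:37:49Z: the three terms of
`∇P = −(1−γ)V − DV[γy] − DV[V]` cost `R^{2−ρ}`, `R^{3−ρ/2}`, `R^{1−3ρ/2}`, all `≤ R^{3−ρ/2}` exactly when `ρ ≥ −2`); the
composer instantiates with `0 < ρ ≤ 1` (`gradPressureL1Growth (by linarith)`).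

HONEST FRAMING: a portrait-instrument piece (pressure budget at scale, t60-ΠLOG) about HYPOTHETICAL profiles; nothing about the
crux E (`PowerGaugeEulerLiouville`, stmt 19832, OPEN) or NS regularity is proved; MODEL-lattice crux class; not E.
[nsreg-p2 R58c §1 S2; cite: ConstantinIgnatovaVicol2026Putative, §3.1.1 eq. (3.3) (the profile equation); folklore]
-/

noncomputable section

set_option linter.dupNamespace false

open MeasureTheory Set Filter Topology Metric Function InnerProductSpace
open scoped ENNReal NNReal RealInnerProductSpace Topology

namespace Summit.NavierStokesRegularity.NavierStokesRegularity.Theorems.PowerGaugeEulerLiouville.PressureSeam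

open Literature.Analysis Literature.Analysis.FluidPDE

/-- **t60-ΠLOG S2 `GradPressureL1Growth ρ` (Sketch58c VERBATIM, δ-unfolded), for `−2 ≤ ρ`**: the `L¹(B_R)` growth
`∫_{B_R} ‖∇P‖ ≤ D R^{3−ρ/2}` of the pressure gradient of a self-similar Euler profile with exponent `1/(2+ρ)` under the
E-budget and the velocity budget (`ρ ≤ 1`).  Proof = the Literature theorem
`IsSelfSimilarEulerProfile.exists_integral_ball_norm_gradient_pressure_le` by name. [nsreg-p2 R58c S2; folklore] -/
theorem gradPressureL1Growth {ρ : ℝ} (hρ : -2 ≤ ρ) :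
    ∀ (V : EuclideanSpace ℝ (Fin 3) → EuclideanSpace ℝ (Fin 3)) (P : EuclideanSpace ℝ (Fin 3) → ℝ),
      IsSelfSimilarEulerProfile (1 / (2 + ρ)) 0 V P →
      (∫⁻ y, ‖fderiv ℝ V y‖ₑ ^ 2 * ENNReal.ofReal (‖y‖ ^ (ρ - 1))) ≠ ⊤ →
      (∃ A : ℝ, ∀ R : ℝ, 1 ≤ R →
        ∫ y in ball (0 : EuclideanSpace ℝ (Fin 3)) R, ‖V y‖ ^ 2 ≤ A * R ^ (1 - 2 * ρ)) →
      ρ ≤ 1 →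
      ∃ D : ℝ, ∀ R : ℝ, 1 ≤ R →
        ∫ y in ball (0 : EuclideanSpace ℝ (Fin 3)) R, ‖gradient P y‖ ≤ D * R ^ (3 - ρ / 2) :=
  fun _V _P h hE hV hρ1 =>
    IsSelfSimilarEulerProfile.exists_integral_ball_norm_gradient_pressure_le hρ hρ1 h hE hV

end Summit.NavierStokesRegularity.NavierStokesRegularity.Theorems.PowerGaugeEulerLiouville.PressureSeam

end
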